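import Summits.QuantumFields.YangMills.Theorems.ColdStartUniversalityLatticeLangevinLatitudeEigen
import Summits.QuantumFields.YangMills.Theorems.ColdStartUniversalityLatticeLangevinQuadraticGenerator
import Summits.QuantumFields.YangMills.Theorems.ColdStartUniversalityLatticeLangevinWilsonHolleyStroock
import Summits.QuantumFields.YangMills.Theorems.ColdStartUniversalityLatticeLangevinCoeffBounds
import HarnessLib

/-!
# Route `ColdStartUniversality` (fixed-cut-off package, `Lᵖ` side): calculus toolkit for Gross's equivalence — the REGULARISED
# POSITIVE CYLINDER `√(F² + ε)` and its carré du champ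

Helper file (seat `ym-line-csu-p1`, g36; `--supports stmt-QuantumFields-24809`).  For a `C³` function `f` of the real link coordinates of
`SU(2)^E` (`F = f∘coords`) and `ε > 0`:
* `exists_sqrt_sq_add_cylinder` — a `C³` COMPACTLY SUPPORTED `g` with `g∘coords = √(F² + ε) > 0` and the carré du champ identity /
  comparison `Σ ∂_ig ∂_jg A_{ij} = (F²/(F²+ε))·Σ ∂_if ∂_jf A_{ij} ≤ Σ ∂_if ∂_jf A_{ij}` at every `coords V` (cut-off near `‖coords V‖ ≤ 1`,
  `exists_contDiff_hasCompactSupport_eqOn`; chain rule for `√`; `carreDuChamp_nonneg`);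
* `continuous_carre_coords` — `V ↦ Σ ∂_ih ∂_jh A_{ij}(V)` is continuous for `C³` `h`.
Used by `…LatticeLangevinHypercontractivityIff` (hypercontractivity ⇒ log-Sobolev on ALL `C³` cylinders).

THEOREMS ONLY, no definition, no sorry.  HONEST FRAMING: calculus bookkeeping at FIXED cut-off; nothing K-uniform; no crux, rung or summit
statement is proved; the Yang–Mills mass gap is NOT proved.
-/

set_option autoImplicit false

noncomputable section

namespace Summit.QuantumFields.YangMills.Theorems.ColdStartUniversality

open MeasureTheory ProbabilityTheory Filter Set Topology
open scoped BigOperators NNReal ENNReal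
open Literature.Probability.Process Literature.MathematicalPhysics.QuantumFieldTheory
open Literature.MathematicalPhysics.QuantumLattice (fundamentalRep fundamentalLatticeRep continuous_fundamentalRep)

variable {L : ℕ} [NeZero L]

/-! ## §1. The regularised cylinder `√(F² + ε)` -/

/-- **The regularised positive cylinder.**  For a `C³` function `f` of the real link coordinates and `ε > 0` there is a `C³`
COMPACTLY SUPPORTED `g` with: `g(coords V) = √(f(coords V)² + ε)` (so `g∘coords > 0` and `(g∘coords)² = F² + ε`), the same
first derivatives
`∂_i g(coords V) = (f(coords V)/√(f(coords V)² + ε))·∂_i f(coords V)` — whence the carré du champ comparison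
`Σ_{ij} ∂_ig ∂_jg A_{ij} = (F²/(F²+ε))·Σ_{ij} ∂_if ∂_jf A_{ij} ≤ Σ_{ij} ∂_if ∂_jf A_{ij}` at `coords V`. [folklore] -/
theorem exists_sqrt_sq_add_cylinder (L : ℕ) [NeZero L] (β' : ℝ)
    {f : (Edge 3 L × Fin 2 × Fin 2 × Bool → ℝ) → ℝ} (hf : ContDiff ℝ 3 f) {ε : ℝ} (hε : 0 < ε) :
    let coords : GaugeConfig 3 L (Matrix.specialUnitaryGroup (Fin 2) ℂ) → (Edge 3 L × Fin 2 × Fin 2 × Bool → ℝ) :=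
      fun V q => (fun z : ℂ => if q.2.2.2 then z.im else z.re)
        ((fundamentalRep (Fin 2) (V q.1) : Matrix (Fin 2) (Fin 2) ℂ) q.2.1 q.2.2.1)
    let A : GaugeConfig 3 L (Matrix.specialUnitaryGroup (Fin 2) ℂ) → (Edge 3 L × Fin 2 × Fin 2 × Bool) →
        (Edge 3 L × Fin 2 × Fin 2 × Bool) → ℝ := fun V i j =>
      ∑ n : Edge 3 L × NoiseIdx 2,
        (if n.1 = i.1 then (fun z : ℂ => if i.2.2.2 then z.im else z.re)
          ((latticeLangevinDynamics (fundamentalLatticeRep 2) β').noise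
            (matrixConfig (fundamentalRep (Fin 2)) V) i.1 n.2 i.2.1 i.2.2.1) else 0) *
        (if n.1 = j.1 then (fun z : ℂ => if j.2.2.2 then z.im else z.re)
          ((latticeLangevinDynamics (fundamentalLatticeRep 2) β').noise
            (matrixConfig (fundamentalRep (Fin 2)) V) j.1 n.2 j.2.1 j.2.2.1) else 0)
    ∃ g : (Edge 3 L × Fin 2 × Fin 2 × Bool → ℝ) → ℝ, ContDiff ℝ 3 g ∧ HasCompactSupport g ∧
      (∀ V, g (coords V) = Real.sqrt (f (coords V) ^ 2 + ε)) ∧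
      (∀ V, 0 < g (coords V)) ∧
      (∀ V, (∑ i : Edge 3 L × Fin 2 × Fin 2 × Bool, ∑ j : Edge 3 L × Fin 2 × Fin 2 × Bool,
          fderiv ℝ g (coords V) (Pi.single i 1) * fderiv ℝ g (coords V) (Pi.single j 1) * A V i j) =
        (f (coords V) ^ 2 / (f (coords V) ^ 2 + ε)) *
          ∑ i : Edge 3 L × Fin 2 × Fin 2 × Bool, ∑ j : Edge 3 L × Fin 2 × Fin 2 × Bool,
            fderiv ℝ f (coords V) (Pi.single i 1) * fderiv ℝ f (coords V) (Pi.single j 1) * A V i j) ∧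
      (∀ V, (∑ i : Edge 3 L × Fin 2 × Fin 2 × Bool, ∑ j : Edge 3 L × Fin 2 × Fin 2 × Bool,
          fderiv ℝ g (coords V) (Pi.single i 1) * fderiv ℝ g (coords V) (Pi.single j 1) * A V i j) ≤
        ∑ i : Edge 3 L × Fin 2 × Fin 2 × Bool, ∑ j : Edge 3 L × Fin 2 × Fin 2 × Bool,
          fderiv ℝ f (coords V) (Pi.single i 1) * fderiv ℝ f (coords V) (Pi.single j 1) * A V i j) := by
  intro coords A
  classical
  -- `g₀ y = √(f y · f y + ε)`, `C³`, and its derivative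
  set g₀ : (Edge 3 L × Fin 2 × Fin 2 × Bool → ℝ) → ℝ := fun y => Real.sqrt (f y * f y + ε) with hg₀
  have hpos₀ : ∀ y, 0 < f y * f y + ε := fun y => by nlinarith [mul_self_nonneg (f y)]
  have hq : ContDiff ℝ 3 fun y => f y * f y + ε := (hf.mul hf).add contDiff_const
  have hg₀c : ContDiff ℝ 3 g₀ := hq.sqrt fun y => (hpos₀ y).ne'
  have hfd : ∀ y, HasFDerivAt f (fderiv ℝ f y) y := fun y => (hf.differentiable (by norm_num) y).hasFDerivAt
  have hg₀d : ∀ y, HasFDerivAt g₀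
      ((1 / (2 * Real.sqrt (f y * f y + ε))) • (f y • fderiv ℝ f y + f y • fderiv ℝ f y)) y := fun y =>
    (((hfd y).mul (hfd y)).add_const ε).sqrt (hpos₀ y).ne'
  have hg₀v : ∀ y (v : Edge 3 L × Fin 2 × Fin 2 × Bool → ℝ),
      fderiv ℝ g₀ y v = (f y / Real.sqrt (f y * f y + ε)) * fderiv ℝ f y v := by
    intro y v
    rw [(hg₀d y).fderiv]
    simp only [_root_.smul_apply, _root_.add_apply, smul_eq_mul]
    have hs : Real.sqrt (f y * f y + ε) ≠ 0 := (Real.sqrt_pos.2 (hpos₀ y)).ne'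
    field_simp
    ring
  -- compactly supported modification, exact near the range `‖coords V‖ ≤ 1`
  obtain ⟨g, hg, hgc, hgeq⟩ := exists_contDiff_hasCompactSupport_eqOn hg₀c 1
  have hnear : ∀ V : GaugeConfig 3 L (Matrix.specialUnitaryGroup (Fin 2) ℂ), g =ᶠ[𝓝 (coords V)] g₀ := fun V =>
    hgeq _ (norm_coords_le_one V)
  have hval : ∀ V, g (coords V) = g₀ (coords V) := fun V => (hnear V).self_of_nhds
  have hfdg : ∀ V, fderiv ℝ g (coords V) = fderiv ℝ g₀ (coords V) := fun V => (hnear V).fderiv_eq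
  have hsq : ∀ V, f (coords V) * f (coords V) = f (coords V) ^ 2 := fun V => (sq _).symm
  refine ⟨g, hg, hgc, fun V => by rw [hval]; show Real.sqrt _ = _; rw [hsq],
    fun V => by rw [hval]; exact Real.sqrt_pos.2 (hpos₀ _), ?_, ?_⟩
  · intro V
    set θ : ℝ := f (coords V) / Real.sqrt (f (coords V) * f (coords V) + ε) with hθ
    have hc : ∀ i : Edge 3 L × Fin 2 × Fin 2 × Bool,
        fderiv ℝ g (coords V) (Pi.single i 1) = θ * fderiv ℝ f (coords V) (Pi.single i 1) := fun i => by
      rw [hfdg, hg₀v]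
    have hθ2 : θ ^ 2 = f (coords V) ^ 2 / (f (coords V) ^ 2 + ε) := by
      rw [hθ, div_pow, Real.sq_sqrt (hpos₀ _).le, hsq]
    rw [← hθ2, Finset.mul_sum]
    refine Finset.sum_congr rfl fun i _ => ?_
    rw [Finset.mul_sum]
    refine Finset.sum_congr rfl fun j _ => ?_
    rw [hc i, hc j]; ring
  · intro V
    have hθle : f (coords V) ^ 2 / (f (coords V) ^ 2 + ε) ≤ 1 := by
      rw [div_le_one (by positivity)]; linarith
    have hΓ0 : 0 ≤ ∑ i : Edge 3 L × Fin 2 × Fin 2 × Bool, ∑ j : Edge 3 L × Fin 2 × Fin 2 × Bool,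
        fderiv ℝ f (coords V) (Pi.single i 1) * fderiv ℝ f (coords V) (Pi.single j 1) * A V i j :=
      carreDuChamp_nonneg (fun i => fderiv ℝ f (coords V) (Pi.single i 1)) _
    -- reuse the identity just proved (first goal) by re-deriving it
    set θ : ℝ := f (coords V) / Real.sqrt (f (coords V) * f (coords V) + ε) with hθ
    have hc : ∀ i : Edge 3 L × Fin 2 × Fin 2 × Bool,
        fderiv ℝ g (coords V) (Pi.single i 1) = θ * fderiv ℝ f (coords V) (Pi.single i 1) := fun i => by
      rw [hfdg, hg₀v]
    have hθ2 : θ ^ 2 = f (coords V) ^ 2 / (f (coords V) ^ 2 + ε) := by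
      rw [hθ, div_pow, Real.sq_sqrt (hpos₀ _).le, hsq]
    have hid : (∑ i : Edge 3 L × Fin 2 × Fin 2 × Bool, ∑ j : Edge 3 L × Fin 2 × Fin 2 × Bool,
        fderiv ℝ g (coords V) (Pi.single i 1) * fderiv ℝ g (coords V) (Pi.single j 1) * A V i j) =
        θ ^ 2 * ∑ i : Edge 3 L × Fin 2 × Fin 2 × Bool, ∑ j : Edge 3 L × Fin 2 × Fin 2 × Bool,
          fderiv ℝ f (coords V) (Pi.single i 1) * fderiv ℝ f (coords V) (Pi.single j 1) * A V i j := by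
      rw [Finset.mul_sum]
      refine Finset.sum_congr rfl fun i _ => ?_
      rw [Finset.mul_sum]
      refine Finset.sum_congr rfl fun j _ => ?_
      rw [hc i, hc j]; ring
    rw [hid, hθ2]
    calc _ ≤ 1 * _ := mul_le_mul_of_nonneg_right hθle hΓ0
      _ = _ := one_mul _

/-! ## §2. Continuity of the carré du champ -/

/-- **Continuity of the carré du champ of a `C³` function along the coordinates.** [folklore] -/
theorem continuous_carre_coords (L : ℕ) [NeZero L] (β' : ℝ)
    {h : (Edge 3 L × Fin 2 × Fin 2 × Bool → ℝ) → ℝ} (hh : ContDiff ℝ 3 h) :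
    Continuous fun V : GaugeConfig 3 L (Matrix.specialUnitaryGroup (Fin 2) ℂ) =>
      ∑ i : Edge 3 L × Fin 2 × Fin 2 × Bool, ∑ j : Edge 3 L × Fin 2 × Fin 2 × Bool,
        fderiv ℝ h ((fun (V : GaugeConfig 3 L (Matrix.specialUnitaryGroup (Fin 2) ℂ)) (q : Edge 3 L × Fin 2 × Fin 2 × Bool) =>
          (fun z : ℂ => if q.2.2.2 then z.im else z.re)
            ((fundamentalRep (Fin 2) (V q.1) : Matrix (Fin 2) (Fin 2) ℂ) q.2.1 q.2.2.1)) V) (Pi.single i 1) *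
        fderiv ℝ h ((fun (V : GaugeConfig 3 L (Matrix.specialUnitaryGroup (Fin 2) ℂ)) (q : Edge 3 L × Fin 2 × Fin 2 × Bool) =>
          (fun z : ℂ => if q.2.2.2 then z.im else z.re)
            ((fundamentalRep (Fin 2) (V q.1) : Matrix (Fin 2) (Fin 2) ℂ) q.2.1 q.2.2.1)) V) (Pi.single j 1) *
        ∑ n : Edge 3 L × NoiseIdx 2,
          (if n.1 = i.1 then (fun z : ℂ => if i.2.2.2 then z.im else z.re)
            ((latticeLangevinDynamics (fundamentalLatticeRep 2) β').noise
              (matrixConfig (fundamentalRep (Fin 2)) V) i.1 n.2 i.2.1 i.2.2.1) else 0) *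
          (if n.1 = j.1 then (fun z : ℂ => if j.2.2.2 then z.im else z.re)
            ((latticeLangevinDynamics (fundamentalLatticeRep 2) β').noise
              (matrixConfig (fundamentalRep (Fin 2)) V) j.1 n.2 j.2.1 j.2.2.1) else 0) := by
  have hco := continuous_coords (L := L)
  have hreim : ∀ (c : Bool) {q : GaugeConfig 3 L (Matrix.specialUnitaryGroup (Fin 2) ℂ) → ℂ}, Continuous q →
      Continuous fun V => (fun z : ℂ => if c then z.im else z.re) (q V) := by
    intro c q hq; cases c
    · exact Complex.continuous_re.comp hq
    · exact Complex.continuous_im.comp hq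
  have hd1 : ∀ v, Continuous fun y : Edge 3 L × Fin 2 × Fin 2 × Bool → ℝ => fderiv ℝ h y v := fun v =>
    (hh.continuous_fderiv (by norm_num)).clm_apply continuous_const
  have hnoise : ∀ (i : Edge 3 L × Fin 2 × Fin 2 × Bool) (n : Edge 3 L × NoiseIdx 2), Continuous fun V : GaugeConfig 3 L
      (Matrix.specialUnitaryGroup (Fin 2) ℂ) => (if n.1 = i.1 then (fun z : ℂ => if i.2.2.2 then z.im else z.re)
        ((latticeLangevinDynamics (fundamentalLatticeRep 2) β').noise (matrixConfig (fundamentalRep (Fin 2)) V)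
          i.1 n.2 i.2.1 i.2.2.1) else 0) := by
    intro i n
    by_cases hni : n.1 = i.1
    · simp only [if_pos hni]
      exact hreim _ ((continuous_apply i.2.2.1).comp ((continuous_apply i.2.1).comp
        (continuous_noise_matrixConfig β' i.1 n.2)))
    · simp only [if_neg hni]; exact continuous_const
  refine continuous_finsetSum _ fun i _ => continuous_finsetSum _ fun j _ => ?_
  exact (((hd1 _).comp hco).mul ((hd1 _).comp hco)).mul (continuous_finsetSum _ fun n _ => (hnoise i n).mul (hnoise j n))

end Summit.QuantumFields.YangMills.Theorems.ColdStartUniversality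

end
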